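import Literature.Analysis.FunctionSpaces.HolderBallLimit
import HarnessLib

/-!
# `C^{2,α}` bounds on an open ball pass to pointwise limits
(helper file for stub O3 `stub_regularity`, layer R2 `helper_holderTwoOfLimit`, line
`margerin-cone-hamilton-rails`, crux `EntropyRung.ChangGurskyYang`, item stmt-SmoothPoincare4-10834)

In the difference-quotient regularity argument for the Gursky–Viaclovsky path equation, the
difference quotients `v_h` of a `C^{2,α}` solution are uniformly bounded in `C^{2,α}` on an
interior chart ball and converge pointwise to a directional derivative `V = ∂_e u`; this file
transfers the uniform bounds to `V`: `V` is `C²` on the ball, `‖Dʲ V‖ ≤ B` there for `j ≤ 2`,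
and `[D² V]_{α} ≤ H` (Gilbarg–Trudinger 2001, the Arzelà step in the proof of Lemma 6.10 and
the compactness Lemma 6.36). It is the specialisation `k = 2`, `F = ℝ` of
`Literature.Analysis.FunctionSpaces.contDiffOn_ball_and_bounds_of_tendsto_of_holderOnWith`
(`HolderBallLimit.lean`: `Cᵏ` Arzelà–Ascoli on the open ball along a subsequence, uniqueness
of pointwise limits, locality of `iteratedFDeriv` on open sets, and passage of norm and Hölder
bounds to pointwise limits).

## References

* D. Gilbarg, N. S. Trudinger, *Elliptic Partial Differential Equations of Second Order*,
  Springer Classics in Mathematics (2001), §6.3, proof of Lemma 6.10; §6.8, Lemma 6.36.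
  [GilbargTrudinger2001]
-/

noncomputable section

-- every `Summit.SmoothPoincare4.SmoothPoincare4.…` name repeats the summit = sub-problem segment (D-0017 layout)
set_option linter.dupNamespace false

namespace Summit.SmoothPoincare4.SmoothPoincare4.Theorems.MargerinRails

/-- **R2: uniform `C^{2,α}` bounds on an open ball pass to pointwise limits.** If the `v n` are
`C²` on the open ball `B(x₀, R)` with `‖Dʲ (v n) y‖ ≤ B` for `y` in the ball and `j ≤ 2`, the
second derivatives are uniformly `α`-Hölder with constant `H` (`0 < α`), and `v n → V`
pointwise on the ball, then `V` is `C²` on the ball with the same bounds (Arzelà–Ascoli;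
Gilbarg–Trudinger 2001, proof of Lemma 6.10 / Lemma 6.36; the tree's
`contDiffOn_ball_and_bounds_of_tendsto_of_holderOnWith`).
[cite: GilbargTrudinger2001, §6.8, Lemma 6.36] -/
theorem helper_holderTwoOfLimit :
    ∀ {E : Type} [NormedAddCommGroup E] [InnerProductSpace ℝ E] [FiniteDimensional ℝ E]
      {x₀ : E} {R : ℝ} {α : NNReal}, 0 < α →
      ∀ {B : ℝ} {H : NNReal} {v : ℕ → E → ℝ} {V : E → ℝ},
      (∀ n, ContDiffOn ℝ 2 (v n) (Metric.ball x₀ R)) →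
      (∀ n, ∀ y ∈ Metric.ball x₀ R, ∀ j ≤ 2, ‖iteratedFDeriv ℝ j (v n) y‖ ≤ B) →
      (∀ n, HolderOnWith H α (iteratedFDeriv ℝ 2 (v n)) (Metric.ball x₀ R)) →
      (∀ y ∈ Metric.ball x₀ R, Filter.Tendsto (fun n => v n y) Filter.atTop (nhds (V y))) →
      ContDiffOn ℝ 2 V (Metric.ball x₀ R) ∧
        (∀ y ∈ Metric.ball x₀ R, ∀ j ≤ 2, ‖iteratedFDeriv ℝ j V y‖ ≤ B) ∧
        HolderOnWith H α (iteratedFDeriv ℝ 2 V) (Metric.ball x₀ R) := by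
  intro E _ _ _ x₀ R α hα B H v V hv hB hH hlim
  exact Literature.Analysis.FunctionSpaces.contDiffOn_ball_and_bounds_of_tendsto_of_holderOnWith
    (k := 2) hα hv hB hH hlim

end Summit.SmoothPoincare4.SmoothPoincare4.Theorems.MargerinRails

end
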